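import Literature.Probability.LatticeModels.BlockExplorationTransportOff
import Literature.Probability.LatticeModels.RandomClusterRegionToAnnulus
import Literature.Probability.LatticeModels.ScaleFrame
import HarnessLib

/-!
# Tools for the two-graph ratio forgetting of Kesten's scheme: positivity and window bookkeeping
(proved)

Topic `Literature/Probability/LatticeModels` (trunk `StatMech`, family `crit-ising`). Small tools for
the comparison of the connection ratios `P_G[x ↔ y] / P_G[x' ↔ y]` of two finite graphs agreeing on a
window (H. Kesten, PTRF 73 (1986), proof of Thm. 3; D. Basu, A. Sapozhnikov, ECP 22 (2017), §2), in the
exploration-from-inside language of `BlockExploration*.lean` (datum event of `(U, R)` with the rim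
wired OFF the inside, inside piece `{x is joined inside U to a vertex carrying an open edge to R}`):

* `exists_mem_of_rcMeasure_real_pos`, `rcWeight_pos_of_mem_Ioo`, `rcMeasure_real_pos_of_coe_mem` —
  for `0 < p < 1` an event is non-null iff it contains a lattice configuration;
* `real_datumOff_insidePiece_pos_of_walk` — **base-walk surgery**: adding to a configuration the edges
  of a walk inside the inner set `In` (whose `G`-neighbours lie in `In ∪ Blk`, `In ∩ Blk = ∅`) keeps
  the off-wired datum event and carries the inside piece from the endpoint `z` of the walk to its
  start `z'`; hence `P[F ∩ InP_z] > 0 → P[F ∩ InP_{z'}] > 0`;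
* `exists_map_eq_of_forall_mem_range` — finite sets inside the range of an embedding are images;
* `real_datumEventOff_pos_of_window` — **realisability is window-local**: for two graphs with the same
  adjacency on a window `W` and a datum `U` such that no vertex of `ι₁ U` has a neighbour off the
  window, the off-wired datum event of `(ι₂ U, ι₂ R)` is non-null in `G₂` as soon as that of
  `(ι₁ U, ι₁ R)` is non-null in `G₁` (restrict a realising configuration to the edges touching `ι₁ U`,
  read it on the window, push it to `G₂`);
* `ScaleFrame.adj_inSet_subset`, `ScaleFrame.image_preimage_inSet`, `ScaleFrame.image_preimage_annSet`
  — frame bookkeeping for a window whose core contains every good vertex below a ceiling.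

Everything is proved; no definitions, no named facts.

## References

* [Kesten1986] H. Kesten, *Probab. Theory Related Fields* 73 (1986) 369–394, proof of Thm. 3.
* [BasuSapozhnikov2017ECP] D. Basu, A. Sapozhnikov, ECP 22 (2017) no. 26, §2.
* G. Grimmett, *The Random-Cluster Model*, Springer (2006), §1.2 eq. (1.2), §4.2–4.3.
-/

open MeasureTheory Finset SimpleGraph
open Literature.Probability.Percolation (BondConfig openConn openConnIn explSet explRim explEvent)

namespace Literature.Probability.LatticeModels

/-! ### Non-null events contain lattice configurations, and conversely for `0 < p < 1` -/

section Positivity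

variable {V : Type*} [Fintype V] [DecidableEq V] (G : SimpleGraph V) [DecidableRel G.Adj]

/-- A non-null event of the random-cluster measure contains a lattice configuration (the measure is
a finite sum of point masses at the edge sets of `G`). [cite: Grimmett2006, §1.2 eq. (1.2)] -/
theorem exists_mem_of_rcMeasure_real_pos {p q : ℝ} (hp : p ∈ Set.Icc (0 : ℝ) 1) (hq : 0 < q)
    (B : Set V) {A : Set (BondConfig V)} (h : 0 < (rcMeasure G p q B).real A) :
    ∃ ω : Finset (Sym2 V), ω ⊆ G.edgeFinset ∧ (↑ω : BondConfig V) ∈ A := by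
  classical
  rw [rcMeasure_real_apply G hp hq B A] at h
  obtain ⟨ω, hω, hne⟩ := Finset.exists_ne_zero_of_sum_ne_zero h.ne'
  refine ⟨ω, Finset.mem_powerset.1 hω, ?_⟩
  by_contra hA
  exact hne (if_neg hA)

/-- For `0 < p < 1`, `q > 0` every edge set has positive random-cluster weight. [cite: Grimmett2006, §1.2 eq. (1.2)] -/
theorem rcWeight_pos_of_mem_Ioo {p q : ℝ} (hp : p ∈ Set.Ioo (0 : ℝ) 1) (hq : 0 < q) (B : Set V)
    (ω : Finset (Sym2 V)) : 0 < rcWeight G p q B ω := by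
  have h0 : 0 < p := hp.1
  have h1 : 0 < 1 - p := sub_pos.2 hp.2
  unfold rcWeight
  positivity

/-- For `0 < p < 1`, an event containing a lattice configuration is non-null. [cite: Grimmett2006, §1.2 eq. (1.2)] -/
theorem rcMeasure_real_pos_of_coe_mem {p q : ℝ} (hp : p ∈ Set.Ioo (0 : ℝ) 1) (hq : 0 < q) (B : Set V)
    {A : Set (BondConfig V)} {ω : Finset (Sym2 V)} (hω : ω ⊆ G.edgeFinset)
    (hA : (↑ω : BondConfig V) ∈ A) : 0 < (rcMeasure G p q B).real A :=
  rcMeasure_real_pos_of_rcWeight_pos G ⟨hp.1.le, hp.2.le⟩ hq B hω hA (rcWeight_pos_of_mem_Ioo G hp hq B ω)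

/-! ### Base-walk surgery: the inside piece moves along a walk inside the inner set -/

/-- **Base-walk surgery.** Let `In ∩ Blk = ∅`, let every `G`-neighbour of `In` lie in `In ∪ Blk`, and
let `w` be a `G`-walk from `z'` to `z` inside `In`. If the off-wired datum event `F` of `(U, R)`
(exploration of `Blk` from `In`, read on `ω ∩ E(G)`) meets the inside piece of `z` with positive
probability, it meets the inside piece of `z'` with positive probability (`0 < p < 1`): add the edges
of `w` to a realising configuration — the datum event only reads edges touching `Blk` and open
edges at `In` (`mem_explEvent_iff_of_agree_on_block`), the wiring clause and the inside piece are
increasing, and `w` joins `z'` to `z` inside `In ⊆ U`. [cite: Kesten1986, proof of Thm. 3] -/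
theorem real_datumOff_insidePiece_pos_of_walk {p q : ℝ} (hp : p ∈ Set.Ioo (0 : ℝ) 1) (hq : 0 < q)
    {In Blk : Set V} (hIB : Disjoint In Blk) (hInadj : ∀ u ∈ In, ∀ v : V, G.Adj u v → v ∈ In ∪ Blk)
    {z z' : V} (w : G.Walk z' z) (hw : ∀ v ∈ w.support, v ∈ In) (U R : Set V)
    (h : 0 < (rcMeasure G p q ∅).real
      ({ω | ω ∩ (↑G.edgeFinset : Set (Sym2 V)) ∈ explEvent In Blk U R ∩
        {ω | ∀ r ∈ R, ∀ r₂ ∈ R, ∃ v ∈ U \ In, ∃ v' ∈ U \ In,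
          s(v, r) ∈ ω ∧ s(v', r₂) ∈ ω ∧ ω ∈ openConnIn (U \ In) v v'}} ∩
      {ω | ∃ wR ∈ R, ∃ v ∈ U, ω ∩ (↑G.edgeFinset : Set (Sym2 V)) ∈ openConnIn U z v ∧
        s(v, wR) ∈ ω ∩ (↑G.edgeFinset : Set (Sym2 V))})) :
    0 < (rcMeasure G p q ∅).real
      ({ω | ω ∩ (↑G.edgeFinset : Set (Sym2 V)) ∈ explEvent In Blk U R ∩
        {ω | ∀ r ∈ R, ∀ r₂ ∈ R, ∃ v ∈ U \ In, ∃ v' ∈ U \ In,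
          s(v, r) ∈ ω ∧ s(v', r₂) ∈ ω ∧ ω ∈ openConnIn (U \ In) v v'}} ∩
      {ω | ∃ wR ∈ R, ∃ v ∈ U, ω ∩ (↑G.edgeFinset : Set (Sym2 V)) ∈ openConnIn U z' v ∧
        s(v, wR) ∈ ω ∩ (↑G.edgeFinset : Set (Sym2 V))}) := by
  classical
  obtain ⟨ω₀, hω₀E, ⟨hFd, hOff⟩, hIn⟩ := exists_mem_of_rcMeasure_real_pos G ⟨hp.1.le, hp.2.le⟩ hq ∅ h
  have hsub₀ : (↑ω₀ : Set (Sym2 V)) ⊆ ↑G.edgeFinset := Finset.coe_subset.2 hω₀E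
  have hω₀ : (↑ω₀ : Set (Sym2 V)) ∩ ↑G.edgeFinset = ↑ω₀ := Set.inter_eq_left.2 hsub₀
  rw [hω₀] at hFd hOff
  rw [Set.mem_setOf_eq, hω₀] at hIn
  -- the edges of the walk, and the enlarged configuration
  set Wk : Finset (Sym2 V) := w.edges.toFinset with hWk
  have hWkE : Wk ⊆ G.edgeFinset := fun e he => by
    rw [hWk, List.mem_toFinset] at he
    exact mem_edgeFinset.2 (w.edges_subset_edgeSet he)
  have hWkIn : ∀ e ∈ Wk, ∀ v ∈ e, v ∈ In := fun e he v hv => by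
    rw [hWk, List.mem_toFinset] at he
    exact hw v (Walk.mem_support_of_mem_edges he hv)
  set ω₁ : Finset (Sym2 V) := ω₀ ∪ Wk with hω₁def
  have hω₁E : ω₁ ⊆ G.edgeFinset := Finset.union_subset hω₀E hWkE
  have hsub₁ : (↑ω₁ : Set (Sym2 V)) ⊆ ↑G.edgeFinset := Finset.coe_subset.2 hω₁E
  have hω₁ : (↑ω₁ : Set (Sym2 V)) ∩ ↑G.edgeFinset = ↑ω₁ := Set.inter_eq_left.2 hsub₁
  have h01 : (↑ω₀ : Set (Sym2 V)) ⊆ ↑ω₁ := Finset.coe_subset.2 Finset.subset_union_left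
  have hmem₁ : ∀ e : Sym2 V, e ∈ (↑ω₁ : Set (Sym2 V)) ↔ e ∈ (↑ω₀ : Set (Sym2 V)) ∨ e ∈ Wk :=
    fun e => by rw [hω₁def, Finset.coe_union, Set.mem_union, Finset.mem_coe, Finset.mem_coe]
  -- `In ⊆ U`
  have hInU : In ⊆ U := hFd.1 ▸ Percolation.subset_explSet In Blk _
  refine rcMeasure_real_pos_of_coe_mem G hp hq ∅ hω₁E ⟨?_, ?_⟩
  · -- the datum event survives the surgery
    rw [Set.mem_setOf_eq, hω₁]
    refine ⟨(Percolation.mem_explEvent_iff_of_agree_on_block ?_ ?_).1 hFd, ?_⟩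
    · -- open edges at `In` end in `In ∪ Blk`
      rintro u hu v huv
      have huv' : s(u, v) ∈ (↑ω₁ : Set (Sym2 V)) := huv.elim (fun h' => h01 h') id
      rcases (hmem₁ _).1 huv' with h' | h'
      · exact hInadj u hu v ((mem_edgeSet (G := G)).1
          (mem_edgeFinset.1 (hω₀E (Finset.mem_coe.1 h'))))
      · exact Or.inl (hWkIn _ h' v (Sym2.mem_mk_right u v))
    · -- the edges touching `Blk` are untouched
      rintro e ⟨v, hvB, hve⟩
      refine ⟨fun h' => h01 h', fun h' => ((hmem₁ e).1 h').elim id fun h'' => ?_⟩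
      exact absurd (hWkIn e h'' v hve) (Set.disjoint_right.1 hIB hvB)
    · -- the wiring clause is increasing
      intro r hr r₂ hr₂
      obtain ⟨v, hv, v', hv', h1, h2, h3⟩ := hOff r hr r₂ hr₂
      exact ⟨v, hv, v', hv', h01 h1, h01 h2, Percolation.isUpperSet_openConnIn _ _ _ h01 h3⟩
  · -- the inside piece moves from `z` to `z'` along the walk
    rw [Set.mem_setOf_eq, hω₁]
    obtain ⟨wR, hwR, v, hv, hzv, hvw⟩ := hIn
    refine ⟨wR, hwR, v, hv, ?_, h01 hvw⟩
    refine Percolation.PlanarDuality.openConnIn_trans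
      (Percolation.mem_openConnIn_of_walk w (fun a ha => hInU (hw a ha)) fun e he => ?_)
      (Percolation.isUpperSet_openConnIn _ _ _ h01 hzv)
    exact (hmem₁ e).2 (Or.inr (by rw [hWk, List.mem_toFinset]; exact he))

end Positivity

/-! ### Finite sets inside the range of an embedding -/

/-- A finite set inside the range of an embedding is the image of a finite set. [folklore] -/
theorem exists_map_eq_of_forall_mem_range {W V : Type*} (ι : W ↪ V) (s : Finset V)
    (h : ∀ v ∈ s, v ∈ Set.range ι) : ∃ t : Finset W, t.map ι = s := by
  classical
  refine ⟨s.preimage ι ι.injective.injOn, ?_⟩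
  ext v
  rw [Finset.mem_map]
  constructor
  · rintro ⟨w, hw, rfl⟩
    exact Finset.mem_preimage.1 hw
  · intro hv
    obtain ⟨w, rfl⟩ := h v hv
    exact ⟨w, Finset.mem_preimage.2 hv, rfl⟩

/-! ### Realisability of a window datum is the same in two graphs agreeing on the window -/

section Window

variable {V₁ V₂ W : Type*} [Fintype V₁] [DecidableEq V₁] [Fintype V₂] [DecidableEq V₂]
  [Fintype W] [DecidableEq W] (G₁ : SimpleGraph V₁) [DecidableRel G₁.Adj] (G₂ : SimpleGraph V₂)
  [DecidableRel G₂.Adj] (ι₁ : W ↪ V₁) (ι₂ : W ↪ V₂)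

/-- **Realisability of a window datum is window-local.** Two finite graphs with the same adjacency on
a window `W`, a window datum `(U, R)` such that no vertex of `ι₁ U` has a neighbour off the window:
if the off-wired datum event of `(ι₁ U, ι₁ R)` (exploration of `ι₁ Blk` from `ι₁ In`) is non-null for
`φ_{G₁}`, then that of `(ι₂ U, ι₂ R)` is non-null for `φ_{G₂}` (`0 < p < 1`): a realising
configuration restricted to the edges touching `ι₁ U` still realises the datum
(`datumEventOff_iff_of_inter_eq`), is the push-forward of a window configuration
(`coe_map_mem_datumEventOff_iff`), whose push-forward to `G₂` realises the datum there.
[cite: BasuSapozhnikov2017ECP, §2] -/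
theorem real_datumEventOff_pos_of_window {p q : ℝ} (hp : p ∈ Set.Ioo (0 : ℝ) 1) (hq : 0 < q)
    (hadj : ∀ a b : W, G₁.Adj (ι₁ a) (ι₁ b) ↔ G₂.Adj (ι₂ a) (ι₂ b)) (In Blk U R : Set W)
    (hU₁ : ∀ a ∈ U, ∀ v : V₁, G₁.Adj (ι₁ a) v → ∃ b : W, v = ι₁ b)
    (h : 0 < (rcMeasure G₁ p q ∅).real {ω : BondConfig V₁ | ω ∩ (↑G₁.edgeFinset : Set (Sym2 V₁)) ∈
        explEvent (ι₁ '' In) (ι₁ '' Blk) (ι₁ '' U) (ι₁ '' R) ∩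
          {ω | ∀ r ∈ ι₁ '' R, ∀ r₂ ∈ ι₁ '' R, ∃ v ∈ ι₁ '' U \ ι₁ '' In, ∃ v' ∈ ι₁ '' U \ ι₁ '' In,
            s(v, r) ∈ ω ∧ s(v', r₂) ∈ ω ∧ ω ∈ openConnIn (ι₁ '' U \ ι₁ '' In) v v'}}) :
    0 < (rcMeasure G₂ p q ∅).real {ω : BondConfig V₂ | ω ∩ (↑G₂.edgeFinset : Set (Sym2 V₂)) ∈
        explEvent (ι₂ '' In) (ι₂ '' Blk) (ι₂ '' U) (ι₂ '' R) ∩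
          {ω | ∀ r ∈ ι₂ '' R, ∀ r₂ ∈ ι₂ '' R, ∃ v ∈ ι₂ '' U \ ι₂ '' In, ∃ v' ∈ ι₂ '' U \ ι₂ '' In,
            s(v, r) ∈ ω ∧ s(v', r₂) ∈ ω ∧ ω ∈ openConnIn (ι₂ '' U \ ι₂ '' In) v v'}} := by
  classical
  obtain ⟨ω₁, -, hω₁F⟩ := exists_mem_of_rcMeasure_real_pos G₁ ⟨hp.1.le, hp.2.le⟩ hq ∅ h
  -- the window pairs touching `U` that are edges (the same for the two graphs)
  set TW : Finset (Sym2 W) :=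
    Finset.univ.filter (fun e => Sym2.map ι₁ e ∈ G₁.edgeSet ∧ ∃ v ∈ U, v ∈ e) with hTWdef
  have hTW₁ : ∀ e, e ∈ TW ↔ Sym2.map ι₁ e ∈ G₁.edgeSet ∧ ∃ v ∈ U, v ∈ e := fun e => by
    rw [hTWdef, Finset.mem_filter, and_iff_right (Finset.mem_univ e)]
  have hTW₂ : ∀ e, e ∈ TW ↔ Sym2.map ι₂ e ∈ G₂.edgeSet ∧ ∃ v ∈ U, v ∈ e := fun e => by
    rw [hTW₁]
    induction e using Sym2.ind with
    | h a b => rw [Sym2.map_mk, Sym2.map_mk, mem_edgeSet, mem_edgeSet, hadj a b]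
  have hT₁ := mem_map_sym2Map_iff_touching G₁ ι₁ hU₁ hTW₁
  -- the realising configuration restricted to the edges touching `ι₁ U`, read on the window
  set ζ : Finset (Sym2 W) := TW.filter (fun e => ι₁.sym2Map e ∈ ω₁) with hζdef
  have hζ : ζ ⊆ TW := Finset.filter_subset _ _
  have hζeq : (↑(ζ.map ι₁.sym2Map) : Set (Sym2 V₁)) = ↑ω₁ ∩ ↑(TW.map ι₁.sym2Map) := by
    ext e
    simp only [Finset.coe_map, Set.mem_image, Finset.mem_coe, hζdef, Finset.mem_filter,
      Set.mem_inter_iff]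
    constructor
    · rintro ⟨e', ⟨he'T, he'ω⟩, rfl⟩
      exact ⟨he'ω, e', he'T, rfl⟩
    · rintro ⟨heω, e', he'T, rfl⟩
      exact ⟨e', ⟨he'T, heω⟩, rfl⟩
  have h1 := (datumEventOff_iff_of_inter_eq G₁ (In' := ι₁ '' In) (Blk' := ι₁ '' Blk) (Rv := ι₁ '' R)
    hT₁ (↑ω₁ : BondConfig V₁) (↑(ζ.map ι₁.sym2Map) : BondConfig V₁)
    (by rw [hζeq, Set.inter_assoc, Set.inter_self])).1 hω₁F
  have h2 := (coe_map_mem_datumEventOff_iff G₁ ι₁ hTW₁ ζ hζ).1 h1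
  have h3 := (coe_map_mem_datumEventOff_iff G₂ ι₂ hTW₂ ζ hζ).2 h2
  refine rcMeasure_real_pos_of_coe_mem G₂ hp hq ∅ (fun e he => ?_) h3
  rw [Finset.mem_map] at he
  obtain ⟨e', he', rfl⟩ := he
  rw [Function.Embedding.sym2Map_apply, mem_edgeFinset]
  exact ((hTW₂ e').1 (hζ he')).1

end Window

/-! ### Frame bookkeeping for a window -/

namespace ScaleFrame

variable {V W : Type*} [Fintype V] [DecidableEq V] (F : ScaleFrame V)

/-- On a frame whose edges are the edges of `G`, a `G`-neighbour of the inside of scale `s` lies inside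
or in the annulus `(s, T)` when `s + η ≤ T ≤ Rmax`. [cite: Kesten1986, §2] -/
theorem adj_inSet_subset (G : SimpleGraph V) [DecidableRel G.Adj] (hE : F.E = G.edgeFinset)
    {s T : ℝ} (hsT : s + F.η ≤ T) (hT : T ≤ F.Rmax) :
    ∀ u ∈ F.inSet s, ∀ v : V, G.Adj u v → v ∈ F.inSet s ∪ F.annSet s T := fun u hu v huv =>
  F.mem_inSet_or_annSet_of_adj hsT hT (e := s(u, v)) (by rw [hE, mem_edgeFinset]; exact huv)
    (Sym2.mem_mk_left u v) (Sym2.mem_mk_right u v) hu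

/-- If every good vertex of radius `< T` is the image of a window point, the inside of every scale
`s < T` is the image of its preimage. [folklore] -/
theorem image_preimage_inSet (ι : W ↪ V) {s T : ℝ} (hsT : s < T)
    (hcore : ∀ v : V, v ∈ F.good → F.rad v < T → v ∈ Set.range ι) :
    ι '' (ι ⁻¹' F.inSet s) = F.inSet s := by
  rw [Set.image_preimage_eq_inter_range, Set.inter_eq_left]
  exact fun v hv => hcore v hv.1 (hv.2.trans_lt hsT)

/-- If every good vertex of radius `< T` is the image of a window point, every annulus below `T` is
the image of its preimage. [folklore] -/
theorem image_preimage_annSet (ι : W ↪ V) {s s' T : ℝ} (hs'T : s' ≤ T)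
    (hcore : ∀ v : V, v ∈ F.good → F.rad v < T → v ∈ Set.range ι) :
    ι '' (ι ⁻¹' F.annSet s s') = F.annSet s s' := by
  rw [Set.image_preimage_eq_inter_range, Set.inter_eq_left]
  exact fun v hv => hcore v hv.1 (hv.2.2.trans_le hs'T)

end ScaleFrame

end Literature.Probability.LatticeModels
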